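import Literature.Analysis.SpecialFunctions.LaguerrePolynomial
import HarnessLib

/-!
# Derivative identities for the generalized Laguerre polynomials

Companion of `LaguerrePolynomial.lean` (which has the Laguerre ODE `laguerre_ode`, the three-term
recurrence `laguerre_three_term` and `derivative_laguerre_succ`). Proved here, as polynomial /
pointwise identities over `ℝ` (no analysis, no orthogonality):

* `laguerre_ode_iterate`, `laguerre_ode_iterate_eval` — the **differentiated Laguerre equation**
  `x·L^{(m+2)} + (α+1+m−x)·L^{(m+1)} + (n−m)·L^{(m)} = 0` for `L = L_n^{(α)}` and every `m`
  [Szegő (5.1.2) differentiated `m` times];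
* `X_mul_derivative_laguerre_succ` — `x·(L_{n+1}^{(α)})′ = (n+1)·L_{n+1}^{(α)} − (n+1+α)·L_n^{(α)}`
  [DLMF 18.9.14], with the pointwise forms `eval_mul_derivative_laguerre_sub` and
  `mul_derivative_laguerre_eq_iff` (`x L_d′(x) = d L_d(x) ⟺ L_{d−1}^{(α)}(x) = 0` when `d + α ≠ 0`):
  the critical points of `X^{-d}`-weighted Laguerre polynomials are the zeros of `L_{d−1}^{(α)}`;
* `laguerre_eval_of_eval_pred_eq_zero` — at a zero `τ` of `L_{d−1}^{(α)}`:
  `d·L_d^{(α)}(τ) = −(d−1+α)·L_{d−2}^{(α)}(τ)` [the three-term recurrence (5.1.10) at the interlacing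
  points].

These are the identities behind the Laguerre-centred sign test for the Jensen polynomials of `ξ`
(critical points of the skeleton = zeros of `L_{d−1}^{(n−1/2)}`; the downward recurrence of the
extremal ratios starts from (5.1.10) at those zeros).

## References
* [Szego1975] G. Szegő, *Orthogonal Polynomials*, AMS Colloq. Publ. 23, 4th ed. (1975), §5.1,
  (5.1.2), (5.1.10), (5.1.14).
* [DLMF] NIST Digital Library of Mathematical Functions, 18.9.14, 18.9.23.
-/
namespace Literature.Analysis.SpecialFunctions
open Polynomial Finset
open scoped Nat
noncomputable section

/-- **Differentiated Laguerre equation**: for every `m`,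
`X·L^{(m+2)} + (α+1+m−X)·L^{(m+1)} + (n−m)·L^{(m)} = 0` for `L = L_n^{(α)}` (differentiate (5.1.2) `m` times).
[cite: Szego1975, (5.1.2)] -/
theorem laguerre_ode_iterate (α : ℝ) (n m : ℕ) :
    X * derivative^[m + 2] (laguerre α n) + (C (α + 1 + m) - X) * derivative^[m + 1] (laguerre α n)
      + C ((n : ℝ) - m) * derivative^[m] (laguerre α n) = 0 := by
  induction m with
  | zero => simpa using laguerre_ode α n
  | succ m ih =>
    have h := congrArg derivative ih
    rw [derivative_zero] at h
    simp only [derivative_add, derivative_mul, derivative_sub, derivative_X, derivative_C, zero_mul,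
      zero_add, one_mul, zero_sub] at h
    rw [show m + 1 + 2 = (m + 2) + 1 by ring, show (m + 2) = (m + 1) + 1 by ring,
      Function.iterate_succ_apply' derivative (m + 1 + 1), Function.iterate_succ_apply' derivative (m + 1),
      Function.iterate_succ_apply' derivative m]
    rw [Function.iterate_succ_apply' derivative (m + 1), Function.iterate_succ_apply' derivative m] at h
    have e1 : (C (α + 1 + ↑(m + 1)) : ℝ[X]) = C (α + 1 + ↑m) + 1 := by
      rw [show (α + 1 + ↑(m + 1) : ℝ) = (α + 1 + ↑m) + 1 by push_cast; ring, C_add, C_1]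
    have e2 : (C ((n : ℝ) - ↑(m + 1)) : ℝ[X]) = C ((n : ℝ) - ↑m) - 1 := by
      rw [show ((n : ℝ) - ↑(m + 1) : ℝ) = ((n : ℝ) - ↑m) - 1 by push_cast; ring, C_sub, C_1]
    rw [e1, e2]
    linear_combination h

/-- The differentiated Laguerre equation at a point:
`x·L^{(m+2)}(x) + (α+1+m−x)·L^{(m+1)}(x) + (n−m)·L^{(m)}(x) = 0`. [cite: Szego1975, (5.1.2)] -/
theorem laguerre_ode_iterate_eval (α : ℝ) (n m : ℕ) (x : ℝ) :
    x * (derivative^[m + 2] (laguerre α n)).eval x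
      + (α + 1 + m - x) * (derivative^[m + 1] (laguerre α n)).eval x
      + ((n : ℝ) - m) * (derivative^[m] (laguerre α n)).eval x = 0 := by
  have h := congrArg (fun p => p.eval x) (laguerre_ode_iterate α n m)
  simpa [eval_add, eval_mul, eval_sub, eval_X, eval_C] using h

/-- `x·(L_{n+1}^{(α)})′ = (n+1)·L_{n+1}^{(α)} − (n+1+α)·L_n^{(α)}` [DLMF 18.9.14 with `n+1` for `n`].
[cite: DLMF, 18.9.14] -/
theorem X_mul_derivative_laguerre_succ (α : ℝ) (n : ℕ) :
    X * derivative (laguerre α (n + 1)) = C ((n : ℝ) + 1) * laguerre α (n + 1) - C ((n : ℝ) + 1 + α) * laguerre α n := by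
  ext k
  rw [coeff_sub, coeff_C_mul, coeff_C_mul]
  rcases k with _ | j
  · rw [coeff_X_mul_zero, coeff_laguerre_of_le α (Nat.zero_le _), coeff_laguerre_of_le α (Nat.zero_le _),
      laguerreCoeff, laguerreCoeff, Nat.sub_zero, Nat.sub_zero, ascPochhammer_eval_succ_right n]
    have hf1 : ((n + 1)! : ℝ) = ((n : ℝ) + 1) * (n ! : ℝ) := by
      rw [Nat.factorial_succ]; push_cast; ring
    rw [hf1]
    have h1 : (n ! : ℝ) ≠ 0 := by positivity
    have h2 : ((n : ℝ) + 1) ≠ 0 := by positivity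
    push_cast
    field_simp
    ring
  · rw [coeff_X_mul, coeff_derivative]
    rcases Nat.lt_or_ge (n + 1) (j + 1) with hj | hj
    · rw [coeff_laguerre_of_lt α hj, coeff_laguerre_of_lt α (by omega : n < j + 1)]
      ring
    · rcases Nat.lt_or_ge n (j + 1) with hj2 | hj2
      · -- j + 1 = n + 1
        have : j = n := by omega
        subst this
        rw [coeff_laguerre_of_le α le_rfl, coeff_laguerre_of_lt α (Nat.lt_succ_self j)]
        ring
      · obtain ⟨m, hm⟩ : ∃ m, n = m + j + 1 := ⟨n - j - 1, by omega⟩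
        subst hm
        rw [coeff_laguerre_of_le α hj, coeff_laguerre_of_le α hj2, laguerreCoeff, laguerreCoeff,
          show m + j + 1 + 1 - (j + 1) = m + 1 by omega, show m + j + 1 - (j + 1) = m by omega,
          ascPochhammer_eval_succ_right m]
        have hf1 : ((m + 1)! : ℝ) = ((m : ℝ) + 1) * (m ! : ℝ) := by
          rw [Nat.factorial_succ]; push_cast; ring
        rw [hf1]
        have h1 : (m ! : ℝ) ≠ 0 := by positivity
        have h2 : ((m : ℝ) + 1) ≠ 0 := by positivity
        have h4 : ((j + 1)! : ℝ) ≠ 0 := by positivity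
        push_cast
        field_simp
        ring

/-- At a zero `τ` of `L_{d−1}^{(α)}` (`2 ≤ d`): `d·L_d^{(α)}(τ) = −(d−1+α)·L_{d−2}^{(α)}(τ)` (the three-term
recurrence at the interlacing points). [cite: Szego1975, (5.1.10)] -/
theorem laguerre_eval_of_eval_pred_eq_zero (α : ℝ) {d : ℕ} (hd : 2 ≤ d) {τ : ℝ}
    (hτ : (laguerre α (d - 1)).eval τ = 0) :
    (d : ℝ) * (laguerre α d).eval τ = -((d : ℝ) - 1 + α) * (laguerre α (d - 2)).eval τ := by
  obtain ⟨k, rfl⟩ : ∃ k, d = k + 2 := ⟨d - 2, by omega⟩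
  have h1 : k + 2 - 1 = k + 1 := by omega
  have h2 : k + 2 - 2 = k := by omega
  rw [h1] at hτ
  rw [h2]
  have h := congrArg (fun p => p.eval τ) (laguerre_three_term α k)
  simp only [eval_mul, eval_C, eval_sub, eval_X, hτ, mul_zero, zero_sub] at h
  push_cast
  linear_combination h

/-- `x·(L_d^{(α)})′(x) − d·L_d^{(α)}(x) = −(d+α)·L_{d−1}^{(α)}(x)` (`1 ≤ d`), evaluated form of DLMF 18.9.14;
in particular the critical points of `X ↦ X^{−d}`-weighted Laguerre polynomials, `x L′ = d L`, are exactly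
the zeros of `L_{d−1}^{(α)}` when `d + α ≠ 0`. [cite: DLMF, 18.9.14] -/
theorem eval_mul_derivative_laguerre_sub (α : ℝ) {d : ℕ} (hd : 1 ≤ d) (x : ℝ) :
    x * (derivative (laguerre α d)).eval x - d * (laguerre α d).eval x
      = -((d : ℝ) + α) * (laguerre α (d - 1)).eval x := by
  obtain ⟨k, rfl⟩ : ∃ k, d = k + 1 := ⟨d - 1, by omega⟩
  have h1 : k + 1 - 1 = k := by omega
  rw [h1]
  have h := congrArg (fun p => p.eval x) (X_mul_derivative_laguerre_succ α k)
  simp only [eval_mul, eval_C, eval_sub, eval_X] at h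
  push_cast
  linear_combination h

/-- `x L_d′(x) = d L_d(x)` iff `L_{d−1}^{(α)}(x) = 0`, for `1 ≤ d` and `d + α ≠ 0` (e.g. `α > −1`).
[cite: DLMF, 18.9.14] -/
theorem mul_derivative_laguerre_eq_iff (α : ℝ) {d : ℕ} (hd : 1 ≤ d) (hα : (d : ℝ) + α ≠ 0) (x : ℝ) :
    x * (derivative (laguerre α d)).eval x = d * (laguerre α d).eval x
      ↔ (laguerre α (d - 1)).eval x = 0 := by
  have h := eval_mul_derivative_laguerre_sub α hd x
  constructor
  · intro hx
    have : -((d : ℝ) + α) * (laguerre α (d - 1)).eval x = 0 := by rw [← h, hx, sub_self]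
    rcases mul_eq_zero.1 this with h0 | h0
    · exact absurd (neg_eq_zero.1 h0) hα
    · exact h0
  · intro hx
    rw [hx, mul_zero] at h
    linarith

end
end Literature.Analysis.SpecialFunctions
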